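import Summits.QuantumFields.YangMills.Theorems.UnitScaleTiltProp7CombHolRatioPerStep
import Literature.MathematicalPhysics.QuantumFieldTheory.Balaban1983to89.BlockAveragingEMLAnalyticMean
import HarnessLib

/-!
# Route `UnitScaleTilt`, crux K1 «MinimiserStabilityRegPr» (stmt-QuantumFields-19200), route-R E′ (A′)-on-Σ, P-A2 (β), row «(n3)-comb» —
# (O2) GROUNDWORK, file F-2b: THE ONE-STEP TRUE LINEARISATION OF PRINT's SINGLE BAR (65)∕(68) AT A CURVED BACKGROUND ON `ℤᵈ`,
# WITH A REMAINDER QUADRATIC IN THE WALK MASSES: `‖Ṽ₁(c) − 1 − (D eml(W₀)[r ↦ Y_{V₀}(loop_r)·W₀,r]·κ₀⁻¹ + κ₀·Y_{V₀}([c₋, c₊])·κ₀⁻¹)‖ ≤ 260·m²`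

«(O2) groundwork — not consumed by any displayed row before the freeze lifts» (★★OWNER `ym3-torus-plan` g29 RULING №20 (2), 2026-08-29).
Cell `ym3-torus`, D-0154 (3c) R3 twin-width seat `ym-routeR-w1` (gen 9); LOCATE of record II `LOCATE-N3COMB-TRANSFER-routeRw1g9.md` (19200 evidence #58) §6 file F-2.
THEOREMS ONLY (0 `def`, 0 `sorry`); `--supports stmt-QuantumFields-19200 --as helper`, count-neutral.  YM₃ on T³ is a ladder rung (R3), not the Clay problem;
nothing here claims `hMcomb`, `hMcomb₂`, (β), `hPA2`, `hcoS`, the stub, the crux, d = 4 or the mass gap.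

THE POINT.  The route-internal rows `hMcomb` (★routeR-w6 g8 SIGNATURE-0: the `ℓ²` single-bar level masses of PRINT's comb tower `tildIter` of
[Balaban1985Averaging] (69)) and `hMcomb₂` (px13 g6, RULING №20 (1): the `ℓ¹` one-step defect telescope of the same tower) both start from ONE analytic
input per level: the one-step map `Ṽ ↦ tild L Ū₀ʲ Ṽ` ((65) at the background `Ū₀ʲ`, lit ✓`B7Eq92Concrete.tildIter_succ` = (68)) linearised with its
TRUE derivative and a remainder quadratic in the `ℓ¹` masses of `Y = Ṽ − 1` along print's block loops `Γ_{c,x} ∪ (−c)` (lit `gammaWord … ++ seg κ (−L)`,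
`Wcx_eq_hol_loop`) and the straight segment `[c₋, c₊]` (`seg κ L`).  This is the `ℤᵈ`∕cornered-comb twin of ★p1 g4's ✓`Prop7HolRatioPerStep` +
✓`norm_avgFun_ratio_sub_one_sub_trueLin_le` (the (0.4) symmetric average on the T³ tower): same recursion `D(s·Γ) = Z_s + R(g_s)D(Γ) + Z_s·R(g_s)D(Γ)`,
same analytic-mean engine (lit ✓`isAnalyticMean_eml`, `norm_eml_add_sub_eml_le`, `norm_fderiv_eml_apply_le`), same constants; what changes is the
alphabet — lit `B7Prop1Explicit.hol`∕`stepHol` on `ℤᵈ`, the covariant walk sum `B7Prop3GeneralRotated.tsum` = print's `(R_{0,y}A)(Γ)` ((58) p.27),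
inverses instead of adjoints (class `U1`), and print's (42) `bavg = expUnit (Xavg) · V(c)` read as `eml` over the corner box `Fin d → Fin L` DIRECTLY
(no chart branch).  The linear operator is written with `fderiv ℂ eml` (no new definition); it is print's `(Q′(V₀)A)_c` of (119) (lit
`B7Prop3GeneralTild.QprimeCov`, certified there as the `t`-derivative along `e^{tA}`) — the identification is bookkeeping left to the consumer's taste.

WHAT IS PROVED (ns `…Theorems.Prop7CombTildTrueLin`; `𝔸` any (nontrivial) C⋆-algebra; every `d`, `L`).  The per-step holonomy bounds along a word of `ℤᵈ`
are part a, ✓`…Prop7CombHolRatioPerStep` (`norm_holRatio_le_of_mass_le`).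
* §1 `coe_expUnit_Xavg_eq_eml` ((42)'s exponential IS `eml` over the corner box), `expUnit_Xavg_mem_unitaryUnits`, `coe_tild_eq`.
* §2 ★★★ `norm_tild_sub_one_sub_trueLin_le` — the title, at any `L`-bond `c = (q, κ)` of `ℤᵈ`.
* §3 ★★ `norm_tildIter_succ_sub_one_sub_trueLin_le` — the same READ AT LEVEL `j → j+1` of print's comb tower through lit ✓`tildIter_succ` ((68)).
HONEST SCOPE.  One averaging step; hypotheses displayed: `V₀` unitary-valued with block loops in the `α ≤ 1∕24` window, `V₁` in `U1`, walk masses `≤ m ≤ 1∕72`.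
The per-level sup∕unitarity suppliers at the member (px17 g4's hP-free `…CombTowerUnitaryOfSkew`) and the two telescopes (`hMcomb` ℓ², `hMcomb₂` ℓ¹) are NOT here.

References: T. Bałaban, CMP **98** (1985) 17–51 [Balaban1985Averaging] ((9) p.18, (42) p.23, (58) p.27, (65)∕(68)∕(69) p.29, Prop. 3 (113)–(124) pp.34–36);
CMP **102** (1985) 277–309 [Balaban1985Variational] ((15) p.280, (44) p.285); CMP **109** (1987) 249–301 [Balaban1987RG1] ((0.4) p.253).
-/

noncomputable section

open scoped BigOperators

namespace Summit.QuantumFields.YangMills.Theorems.Prop7CombTildTrueLin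

open NormedSpace
open Literature.MathematicalPhysics.QuantumFieldTheory.Balaban1983to89
open ExpMeanLog (eml eml_eq_exp_sum)
open B7Prop1Explicit (Site Letter hol stepHol seg boxVec gammaWord Wcx Xavg bavg expUnit val_expUnit U1 mem_U1 stepA)
open B7Prop2Explicit (unitaryUnits bavg_mem_unitaryUnits unitaryUnits_le_U1 avgIter hol_mem_of)
open B7Eq92Concrete (tild tild_apply tildIter tildIter_succ)
open B7Prop3GeneralRotated (tsum)
open B7TransferAnalyticMean BlockAveragingEMLAnalyticMean
open Summit.QuantumFields.YangMills.Theorems.Prop7HolRatioPerStep (pi_norm_le_of_forall)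
open Summit.QuantumFields.YangMills.Theorems.Prop7CombHolRatioPerStep
  (norm_coe_le_one_of_mem_U1 norm_coe_inv_le_one_of_mem_U1 norm_holRatio_le_of_mass_le)

section OneStep

variable {d : ℕ} {𝔸 : Type*} [CStarAlgebra 𝔸] [Nontrivial 𝔸]

/-! ## §1 Print's (42) read as `eml` over the corner box -/

omit [Nontrivial 𝔸] in
/-- **(42)'s exponential IS the exp-mean-log over the corner box**: `exp X_c = eml (r ↦ V(Γ_{c,x_r})V(c)⁻¹)`, `x_r = q + r`, `r ∈ [0,L)ᵈ`
(`card (Fin d → Fin L) = Lᵈ`; same two lines as ✓`Prop7CombAccFrameStep.coe_wframe_eq_eml` for the frame (82)). [cite: Balaban1985Averaging, (42) p.23; Balaban1987RG1, (0.4) p.253] -/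
theorem coe_expUnit_Xavg_eq_eml (L : ℕ) (V : Site d → Fin d → 𝔸ˣ) (q : Site d) (κ : Fin d) :
    ((expUnit (Xavg L V q κ) : 𝔸ˣ) : 𝔸) = eml (fun r : Fin d → Fin L => ((Wcx L V q κ (boxVec L r) : 𝔸ˣ) : 𝔸)) := by
  rw [val_expUnit, eml_eq_exp_sum, Xavg]
  congr 1
  refine Finset.sum_congr rfl fun r _ => ?_
  rw [Fintype.card_fun, Fintype.card_fin, Fintype.card_fin, Nat.cast_pow]

omit [Nontrivial 𝔸] in
/-- `(42)`: `V̄(c) = exp X_c · V(c)`, so `exp X_c = V̄(c)·V(c)⁻¹`. [cite: Balaban1985Averaging, (42) p.23] -/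
theorem expUnit_Xavg_eq (L : ℕ) (V : Site d → Fin d → 𝔸ˣ) (q : Site d) (κ : Fin d) :
    expUnit (Xavg L V q κ) = bavg L V q κ * (hol V q (seg κ (L : ℤ)))⁻¹ := by
  rw [bavg, mul_inv_cancel_right]

omit [Nontrivial 𝔸] in
/-- **The correction factor `exp X_c` of a unitary-valued configuration is unitary** once the block loops are in the `¼`-window
(lit ✓`bavg_mem_unitaryUnits` and `V(c)` unitary). [cite: Balaban1985Averaging, (22)-(23) p.21, (42) p.23] -/
theorem expUnit_Xavg_mem_unitaryUnits (L : ℕ) {V : Site d → Fin d → 𝔸ˣ} (hV : ∀ x μ, V x μ ∈ unitaryUnits 𝔸) (q : Site d) (κ : Fin d)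
    (hW : ∀ r : Fin d → Fin L, ‖((Wcx L V q κ (boxVec L r) : 𝔸ˣ) : 𝔸) - 1‖ ≤ 1 / 4) :
    expUnit (Xavg L V q κ) ∈ unitaryUnits 𝔸 := by
  rw [expUnit_Xavg_eq]
  exact (unitaryUnits 𝔸).mul_mem (bavg_mem_unitaryUnits hV L q κ hW) ((unitaryUnits 𝔸).inv_mem (hol_mem_of hV _ _))

omit [Nontrivial 𝔸] in
/-- `(65)` on the algebra: `Ṽ₁(c) = (exp X_c[V₁V₀] · (V₁V₀)(c)) · (V₀(c)⁻¹ · (exp X_c[V₀])⁻¹)`. [cite: Balaban1985Averaging, (65) p.29, (42) p.23] -/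
theorem coe_tild_eq (L : ℕ) (V₀ V₁ : Site d → Fin d → 𝔸ˣ) (q : Site d) (κ : Fin d) :
    ((tild L V₀ V₁ q κ : 𝔸ˣ) : 𝔸)
      = ((expUnit (Xavg L (V₁ * V₀) q κ) : 𝔸ˣ) : 𝔸) * ((hol (V₁ * V₀) q (seg κ (L : ℤ)) : 𝔸ˣ) : 𝔸)
          * ((((hol V₀ q (seg κ (L : ℤ)))⁻¹ : 𝔸ˣ) : 𝔸) * (((expUnit (Xavg L V₀ q κ))⁻¹ : 𝔸ˣ) : 𝔸)) := by
  rw [tild_apply, bavg, bavg, mul_inv_rev, Units.val_mul, Units.val_mul, Units.val_mul]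

/-! ## §2 ★★★ The one-step true linearisation of the single bar with a walk-mass remainder -/

/-- Block loops of a unitary-valued configuration are in `U1` (norm `≤ 1`). [cite: Balaban1985Averaging, (19) p.21] -/
theorem norm_coe_Wcx_le_one (L : ℕ) {V : Site d → Fin d → 𝔸ˣ} (hV : ∀ x μ, V x μ ∈ unitaryUnits 𝔸) (q : Site d) (κ : Fin d) (r : Site d) :
    ‖((Wcx L V q κ r : 𝔸ˣ) : 𝔸)‖ ≤ 1 := by
  have h : Wcx L V q κ r ∈ unitaryUnits 𝔸 := by
    unfold Wcx
    exact (unitaryUnits 𝔸).mul_mem (hol_mem_of hV _ _) ((unitaryUnits 𝔸).inv_mem (hol_mem_of hV _ _))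
  exact norm_coe_le_one_of_mem_U1 (unitaryUnits_le_U1 h)

/-- ★★★ **PRINT's SINGLE BAR (65) AT A CURVED BACKGROUND, LINEARISED WITH THE TRUE DERIVATIVE, REMAINDER QUADRATIC IN THE WALK MASSES.**
Background `V₀` unitary-valued with block loops `W₀,r = V₀(Γ_{c,x_r})V₀(c)⁻¹` within `α ≤ 1∕24` of `1`; `V₁` with values in `U1`, `Y = V₁ − 1`; every block loop
`Γ_{c,x_r} ∪ (−c)` (lit `gammaWord … ++ seg κ (−L)`) and the straight segment `[c₋, c₊]` carry `ℓ¹` mass `Σ_s‖Y_{b(s)}‖ ≤ m`, `72m ≤ 1`.  Then, with `κ₀ = exp X_c[V₀]`,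
`Λ_r = (R_{0,c₋}Y)(Γ_{c,x_r} ∪ (−c))`, `Λ_S = (R_{0,c₋}Y)([c₋, c₊])`:
`‖Ṽ₁(c) − 1 − (D eml(W₀)[r ↦ Λ_r·W₀,r]·κ₀⁻¹ + κ₀·Λ_S·κ₀⁻¹)‖ ≤ 260·m²` — the cornered-comb∕`ℤᵈ` twin of ✓`norm_avgFun_ratio_sub_one_sub_trueLin_le` (same engine,
same constants; inverses for adjoints; no chart branch since (42) IS `eml`). The linear operator is print's `(Q′(V₀)Y)_c` (119) (lit `B7Prop3GeneralTild.QprimeCov`).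
«(O2) groundwork — not consumed by any displayed row before the freeze lifts.» [cite: Balaban1985Averaging, (65) p.29, Prop. 3 (113)-(124) pp.34-36] -/
theorem norm_tild_sub_one_sub_trueLin_le (L : ℕ) (V₀ V₁ : Site d → Fin d → 𝔸ˣ) (hV₀ : ∀ x μ, V₀ x μ ∈ unitaryUnits 𝔸)
    (hV₁ : ∀ x μ, V₁ x μ ∈ U1 𝔸) (Y : Site d → Fin d → 𝔸) (hY : ∀ x μ, Y x μ = ((V₁ x μ : 𝔸ˣ) : 𝔸) - 1) (q : Site d) (κ : Fin d) {m α : ℝ}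
    (hmL : ∀ r : Fin d → Fin L,
      ((List.zip (List.scanl (fun (y : Site d) (l' : Letter d) => y + l'.vec) q (gammaWord L κ (boxVec L r) ++ seg κ (-(L : ℤ))))
          (gammaWord L κ (boxVec L r) ++ seg κ (-(L : ℤ)))).map fun s => ‖stepA Y s.1 s.2‖).sum ≤ m)
    (hmS : ((List.zip (List.scanl (fun (y : Site d) (l' : Letter d) => y + l'.vec) q (seg κ (L : ℤ))) (seg κ (L : ℤ))).map
      fun s => ‖stepA Y s.1 s.2‖).sum ≤ m)
    (hm72 : 72 * m ≤ 1) (hα : ∀ r : Fin d → Fin L, ‖((Wcx L V₀ q κ (boxVec L r) : 𝔸ˣ) : 𝔸) - 1‖ ≤ α) (hα24 : α ≤ 1 / 24) :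
    ‖((tild L V₀ V₁ q κ : 𝔸ˣ) : 𝔸) - 1
        - (fderiv ℂ (eml : ((Fin d → Fin L) → 𝔸) → 𝔸) (fun r => ((Wcx L V₀ q κ (boxVec L r) : 𝔸ˣ) : 𝔸))
              (fun r => tsum V₀ Y q (gammaWord L κ (boxVec L r) ++ seg κ (-(L : ℤ))) * ((Wcx L V₀ q κ (boxVec L r) : 𝔸ˣ) : 𝔸))
              * (((expUnit (Xavg L V₀ q κ))⁻¹ : 𝔸ˣ) : 𝔸)
            + ((expUnit (Xavg L V₀ q κ) : 𝔸ˣ) : 𝔸) * tsum V₀ Y q (seg κ (L : ℤ)) * (((expUnit (Xavg L V₀ q κ))⁻¹ : 𝔸ˣ) : 𝔸))‖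
      ≤ 260 * m ^ 2 := by
  -- letters
  have hm0 : 0 ≤ m := (List.sum_nonneg fun y hy => by obtain ⟨z, _, rfl⟩ := List.mem_map.mp hy; exact norm_nonneg _).trans hmS
  have hm1 : m ≤ 1 := by linarith
  have hV₀' : ∀ x μ, V₀ x μ ∈ U1 𝔸 := fun x μ => unitaryUnits_le_U1 (hV₀ x μ)
  set W : (Fin d → Fin L) → 𝔸 := fun r => ((Wcx L (V₁ * V₀) q κ (boxVec L r) : 𝔸ˣ) : 𝔸) with hW
  set W₀ : (Fin d → Fin L) → 𝔸 := fun r => ((Wcx L V₀ q κ (boxVec L r) : 𝔸ˣ) : 𝔸) with hW₀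
  set Λ : (Fin d → Fin L) → 𝔸 := fun r => tsum V₀ Y q (gammaWord L κ (boxVec L r) ++ seg κ (-(L : ℤ))) with hΛ
  -- the loop ratios, per loop, from the per-step bounds (lit `Wcx_eq_hol_loop`: the block loop IS the holonomy of `Γ_{c,x} ∪ (−c)`)
  have hratio : ∀ r, ‖W r * (((Wcx L V₀ q κ (boxVec L r))⁻¹ : 𝔸ˣ) : 𝔸) - 1‖ ≤ 2 * m ∧
      ‖W r * (((Wcx L V₀ q κ (boxVec L r))⁻¹ : 𝔸ˣ) : 𝔸) - 1 - Λ r‖ ≤ 2 * m ^ 2 := by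
    intro r
    have h := norm_holRatio_le_of_mass_le V₀ V₁ hV₀' hV₁ Y hY q (gammaWord L κ (boxVec L r) ++ seg κ (-(L : ℤ))) (hmL r) hm1
    simp only [hW, hΛ, B7Prop1Explicit.Wcx_eq_hol_loop]
    exact h
  -- the background loop variables: size and norm
  have hW₀1 : ∀ r, ‖W₀ r - 1‖ ≤ α := fun r => hα r
  have hW₀n : ∀ r, ‖W₀ r‖ ≤ 1 := fun r => norm_coe_Wcx_le_one L hV₀ q κ _
  have hW₀u : ∀ r, (((Wcx L V₀ q κ (boxVec L r))⁻¹ : 𝔸ˣ) : 𝔸) * W₀ r = 1 := fun r => Units.inv_mul _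
  -- the increments `V = W − W₀` and their linear parts `Λ·W₀`
  set V : (Fin d → Fin L) → 𝔸 := W - W₀ with hV
  set Vl : (Fin d → Fin L) → 𝔸 := fun r => Λ r * W₀ r with hVl
  have hVi : ∀ r, V r = (W r * (((Wcx L V₀ q κ (boxVec L r))⁻¹ : 𝔸ˣ) : 𝔸) - 1) * W₀ r := fun r => by
    simp only [hV, Pi.sub_apply]; rw [sub_mul, mul_assoc, hW₀u, mul_one, one_mul]
  have hVn : ∀ r, ‖V r‖ ≤ 2 * m := fun r => by
    rw [hVi]
    exact (norm_mul_le _ _).trans ((mul_le_mul (hratio r).1 (hW₀n r) (norm_nonneg _) (by positivity)).trans (by rw [mul_one]))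
  have hVVl : ∀ r, ‖V r - Vl r‖ ≤ 2 * m ^ 2 := fun r => by
    have e : V r - Vl r = (W r * (((Wcx L V₀ q κ (boxVec L r))⁻¹ : 𝔸ˣ) : 𝔸) - 1 - Λ r) * W₀ r := by rw [hVi, hVl]; noncomm_ring
    rw [e]
    exact (norm_mul_le _ _).trans ((mul_le_mul (hratio r).2 (hW₀n r) (norm_nonneg _) (by positivity)).trans (by rw [mul_one]))
  -- the correction factors as `eml`
  set κ₁ : 𝔸 := ((expUnit (Xavg L (V₁ * V₀) q κ) : 𝔸ˣ) : 𝔸) with hκ₁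
  set κ₀ : 𝔸 := ((expUnit (Xavg L V₀ q κ) : 𝔸ˣ) : 𝔸) with hκ₀
  set κ₀i : 𝔸 := (((expUnit (Xavg L V₀ q κ))⁻¹ : 𝔸ˣ) : 𝔸) with hκ₀i
  have hκ₁eml : κ₁ = eml (W₀ + V) := by rw [hκ₁, coe_expUnit_Xavg_eq_eml, hV, add_sub_cancel]
  have hκ₀eml : κ₀ = eml W₀ := by rw [hκ₀, coe_expUnit_Xavg_eq_eml]
  -- sup norms of the families
  have hW₀sup : ‖W₀ - 1‖ ≤ 1 / 24 := pi_norm_le_of_forall (by norm_num) fun r => (hW₀1 r).trans hα24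
  have hW₀sup6 : ‖W₀ - 1‖ ≤ 1 / 6 := hW₀sup.trans (by norm_num)
  have hVsup : ‖V‖ ≤ 2 * m := pi_norm_le_of_forall (by positivity) fun r => hVn r
  have hVsup' : ‖V‖ ≤ 1 / 24 := hVsup.trans (by linarith)
  have hVVlsup : ‖V - Vl‖ ≤ 2 * m ^ 2 := pi_norm_le_of_forall (by positivity) fun r => by simpa only [Pi.sub_apply] using hVVl r
  -- `H = κ₁ − κ₀` against the true derivative `D = D eml(W₀)[Vl]`
  set H : 𝔸 := κ₁ - κ₀ with hH
  set D : 𝔸 := fderiv ℂ (eml : ((Fin d → Fin L) → 𝔸) → 𝔸) W₀ Vl with hD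
  have hE₁ : ‖eml (W₀ + V) - eml W₀ - fderiv ℂ (eml : ((Fin d → Fin L) → 𝔸) → 𝔸) W₀ V‖ ≤ 190 * m ^ 2 := by
    have hA := isAnalyticMean_eml (ι := Fin d → Fin L) (𝔸 := 𝔸)
    have hUball : W₀ ∈ Metric.ball (1 : (Fin d → Fin L) → 𝔸) (1 / 3) := by
      rw [Metric.mem_ball, dist_eq_norm]; linarith
    have hV4 : 4 * ‖V‖ ≤ 1 / 3 - ‖W₀ - 1‖ := by linarith
    have h1 := hA.norm_sub_sub_fderiv_le hUball hV4
    have hden : (7 / 24 : ℝ) ≤ 1 / 3 - ‖W₀ - 1‖ := by linarith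
    have hpos : (0 : ℝ) < (1 / 3 - ‖W₀ - 1‖) ^ 2 := by positivity
    refine h1.trans ?_
    rw [div_le_iff₀ hpos]
    have hsq : (7 / 24 : ℝ) ^ 2 ≤ (1 / 3 - ‖W₀ - 1‖) ^ 2 := pow_le_pow_left₀ (by norm_num) hden 2
    have hV2 : ‖V‖ ^ 2 ≤ (2 * m) ^ 2 := pow_le_pow_left₀ (norm_nonneg _) hVsup 2
    nlinarith [sq_nonneg m, mul_le_mul_of_nonneg_left hsq (sq_nonneg m)]
  have hE₂ : ‖fderiv ℂ (eml : ((Fin d → Fin L) → 𝔸) → 𝔸) W₀ V - D‖ ≤ 12 * m ^ 2 := by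
    rw [hD, ← map_sub]
    exact (norm_fderiv_eml_apply_le hW₀sup6 _).trans (by linarith)
  have hHD : ‖H - D‖ ≤ 202 * m ^ 2 := by
    have e : H - D = (eml (W₀ + V) - eml W₀ - fderiv ℂ (eml : ((Fin d → Fin L) → 𝔸) → 𝔸) W₀ V)
        + (fderiv ℂ (eml : ((Fin d → Fin L) → 𝔸) → 𝔸) W₀ V - D) := by rw [hH, hκ₁eml, hκ₀eml]; abel
    rw [e]; exact (norm_add_le _ _).trans (by linarith)
  have hHn : ‖H‖ ≤ 24 * m := by
    rw [hH, hκ₁eml, hκ₀eml]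
    exact (norm_eml_add_sub_eml_le hW₀sup6 hVsup').trans (by linarith)
  -- the background correction factor is unitary: norms of `κ₀`, `κ₀⁻¹` are `≤ 1`, and `κ₀κ₀⁻¹ = 1`
  have hwin : ∀ r : Fin d → Fin L, ‖((Wcx L V₀ q κ (boxVec L r) : 𝔸ˣ) : 𝔸) - 1‖ ≤ 1 / 4 := fun r => (hα r).trans (hα24.trans (by norm_num))
  have hκ₀U1 : expUnit (Xavg L V₀ q κ) ∈ U1 𝔸 := unitaryUnits_le_U1 (expUnit_Xavg_mem_unitaryUnits L hV₀ q κ hwin)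
  have hκ₀n : ‖κ₀‖ ≤ 1 := norm_coe_le_one_of_mem_U1 hκ₀U1
  have hκ₀in : ‖κ₀i‖ ≤ 1 := norm_coe_inv_le_one_of_mem_U1 hκ₀U1
  have hκ₀u : κ₀ * κ₀i = 1 := Units.mul_inv _
  -- the straight factors
  set S : 𝔸 := ((hol (V₁ * V₀) q (seg κ (L : ℤ)) : 𝔸ˣ) : 𝔸) with hS
  set S₀i : 𝔸 := (((hol V₀ q (seg κ (L : ℤ)))⁻¹ : 𝔸ˣ) : 𝔸) with hS₀i
  set ΛS : 𝔸 := tsum V₀ Y q (seg κ (L : ℤ)) with hΛS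
  set G : 𝔸 := S * S₀i - 1 with hG
  have hGb : ‖G‖ ≤ 2 * m ∧ ‖G - ΛS‖ ≤ 2 * m ^ 2 := norm_holRatio_le_of_mass_le V₀ V₁ hV₀' hV₁ Y hY q (seg κ (L : ℤ)) hmS hm1
  -- the algebra: `κ₁S(S₀⁻¹κ₀⁻¹) − 1 − (Dκ₀⁻¹ + κ₀Λ_Sκ₀⁻¹) = (H − D)κ₀⁻¹ + HGκ₀⁻¹ + κ₀(G − Λ_S)κ₀⁻¹`
  have e : κ₁ * S * (S₀i * κ₀i) - 1 - (D * κ₀i + κ₀ * ΛS * κ₀i) = (H - D) * κ₀i + H * G * κ₀i + κ₀ * (G - ΛS) * κ₀i := by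
    rw [hH, hG]
    have e1 : κ₁ * S * (S₀i * κ₀i) = κ₁ * (S * S₀i - 1) * κ₀i + (κ₁ - κ₀) * κ₀i + κ₀ * κ₀i := by noncomm_ring
    rw [e1, hκ₀u]
    noncomm_ring
  rw [coe_tild_eq]
  show ‖κ₁ * S * (S₀i * κ₀i) - 1 - (D * κ₀i + κ₀ * ΛS * κ₀i)‖ ≤ 260 * m ^ 2
  rw [e]
  have h1 : ‖(H - D) * κ₀i‖ ≤ 202 * m ^ 2 :=
    (norm_mul_le _ _).trans ((mul_le_mul hHD hκ₀in (norm_nonneg _) (by positivity)).trans (by rw [mul_one]))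
  have h2 : ‖H * G * κ₀i‖ ≤ 24 * m * (2 * m) := by
    refine (norm_mul_le _ _).trans ?_
    refine (mul_le_mul ((norm_mul_le _ _).trans (mul_le_mul hHn hGb.1 (norm_nonneg _) (by positivity))) hκ₀in (norm_nonneg _)
      (by positivity)).trans ?_
    rw [mul_one]
  have h3 : ‖κ₀ * (G - ΛS) * κ₀i‖ ≤ 2 * m ^ 2 := by
    refine (norm_mul_le _ _).trans ?_
    refine (mul_le_mul ((norm_mul_le _ _).trans (mul_le_mul hκ₀n hGb.2 (norm_nonneg _) zero_le_one)) hκ₀in (norm_nonneg _)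
      (by positivity)).trans ?_
    rw [one_mul, mul_one]
  calc ‖(H - D) * κ₀i + H * G * κ₀i + κ₀ * (G - ΛS) * κ₀i‖
      ≤ ‖(H - D) * κ₀i‖ + ‖H * G * κ₀i‖ + ‖κ₀ * (G - ΛS) * κ₀i‖ := (norm_add_le _ _).trans (add_le_add (norm_add_le _ _) le_rfl)
    _ ≤ 202 * m ^ 2 + 24 * m * (2 * m) + 2 * m ^ 2 := add_le_add (add_le_add h1 h2) h3
    _ ≤ 260 * m ^ 2 := by nlinarith [sq_nonneg m]

/-! ## §3 ★★ The same, read at level `j → j + 1` of print's comb tower -/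

/-- ★★ **ONE STEP OF PRINT's COMB TOWER (68)∕(69), LINEARISED**: with `Ū₀ʲ = avgIter L U₀ j`, `Ũʲ = tildIter L U₀ U₁ j`, `Y_j = Ũʲ − 1`, at the level-`(j+1)` bond
`(z, κ)` (corner `q = L•z` on level `j`): `Ũ^{j+1}(z, κ) = Ṽ(c)[V₀ := Ū₀ʲ, V₁ := Ũʲ]` (lit ✓`tildIter_succ`), hence under the hypotheses of §2 at level `j`
`‖Ũ^{j+1}(z,κ) − 1 − (D eml(W₀ʲ)[r ↦ Λ_r·W₀ʲ,r]·κ₀⁻¹ + κ₀·Λ_S·κ₀⁻¹)‖ ≤ 260·m²` — the one-step input of the `hMcomb`∕`hMcomb₂` telescopes for the object of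
★routeR-w6's SIGNATURE-0. «(O2) groundwork — not consumed by any displayed row before the freeze lifts.» [cite: Balaban1985Averaging, (68)-(69) p.29, Prop. 3 (113)-(124) pp.34-36] -/
theorem norm_tildIter_succ_sub_one_sub_trueLin_le (L : ℕ) (U₀ U₁ : Site d → Fin d → 𝔸ˣ) (j : ℕ)
    (hV₀ : ∀ x μ, avgIter L U₀ j x μ ∈ unitaryUnits 𝔸) (hV₁ : ∀ x μ, tildIter L U₀ U₁ j x μ ∈ U1 𝔸)
    (Y : Site d → Fin d → 𝔸) (hY : ∀ x μ, Y x μ = ((tildIter L U₀ U₁ j x μ : 𝔸ˣ) : 𝔸) - 1) (z : Site d) (κ : Fin d) {m α : ℝ}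
    (hmL : ∀ r : Fin d → Fin L,
      ((List.zip (List.scanl (fun (y : Site d) (l' : Letter d) => y + l'.vec) ((L : ℤ) • z) (gammaWord L κ (boxVec L r) ++ seg κ (-(L : ℤ))))
          (gammaWord L κ (boxVec L r) ++ seg κ (-(L : ℤ)))).map fun s => ‖stepA Y s.1 s.2‖).sum ≤ m)
    (hmS : ((List.zip (List.scanl (fun (y : Site d) (l' : Letter d) => y + l'.vec) ((L : ℤ) • z) (seg κ (L : ℤ))) (seg κ (L : ℤ))).map
      fun s => ‖stepA Y s.1 s.2‖).sum ≤ m)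
    (hm72 : 72 * m ≤ 1)
    (hα : ∀ r : Fin d → Fin L, ‖((Wcx L (avgIter L U₀ j) ((L : ℤ) • z) κ (boxVec L r) : 𝔸ˣ) : 𝔸) - 1‖ ≤ α) (hα24 : α ≤ 1 / 24) :
    ‖((tildIter L U₀ U₁ (j + 1) z κ : 𝔸ˣ) : 𝔸) - 1
        - (fderiv ℂ (eml : ((Fin d → Fin L) → 𝔸) → 𝔸) (fun r => ((Wcx L (avgIter L U₀ j) ((L : ℤ) • z) κ (boxVec L r) : 𝔸ˣ) : 𝔸))
              (fun r => tsum (avgIter L U₀ j) Y ((L : ℤ) • z) (gammaWord L κ (boxVec L r) ++ seg κ (-(L : ℤ)))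
                * ((Wcx L (avgIter L U₀ j) ((L : ℤ) • z) κ (boxVec L r) : 𝔸ˣ) : 𝔸))
              * (((expUnit (Xavg L (avgIter L U₀ j) ((L : ℤ) • z) κ))⁻¹ : 𝔸ˣ) : 𝔸)
            + ((expUnit (Xavg L (avgIter L U₀ j) ((L : ℤ) • z) κ) : 𝔸ˣ) : 𝔸) * tsum (avgIter L U₀ j) Y ((L : ℤ) • z) (seg κ (L : ℤ))
              * (((expUnit (Xavg L (avgIter L U₀ j) ((L : ℤ) • z) κ))⁻¹ : 𝔸ˣ) : 𝔸))‖
      ≤ 260 * m ^ 2 := by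
  rw [tildIter_succ]
  exact norm_tild_sub_one_sub_trueLin_le L (avgIter L U₀ j) (tildIter L U₀ U₁ j) hV₀ hV₁ Y hY ((L : ℤ) • z) κ hmL hmS hm72 hα hα24

end OneStep

end Summit.QuantumFields.YangMills.Theorems.Prop7CombTildTrueLin

end
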